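import Summits.Ventures.DiscreteObjects.Hadamard.PrimeOrderAutomorphism

/-!
# Orbits of a permutation acting freely with `κ^n = 1`: listing, cardinality, orbit sums (kernel, general)

Framing: lottery ticket; floor = certified bounds/negative ranges.

Cell pub-namedobj (venture DiscreteObjects), target (H), hadamard gen 11.  The orbit finset `orbFin κ n j = {κ^k j : k < n}` of
`PrimeOrderAutomorphism` was developed for PRIME `n`; here the same finset is handled for a point `j` on which `κ` acts FREELY
(`κ^k j ≠ j` for `0 < k < n`, and `κ^n = 1`), e.g. `n = 161` composite: the listing `k ↦ κ^k j` is injective on `k < n`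
(`orbFin_injOn_of_free`), the orbit has `n` elements, orbit sums are sums over `k < n` (`sum_orbFin_of_free`), orbits of
points of an orbit coincide, distinct orbits are disjoint, and orbit sums are invariant under every power of `κ`
(`sum_orbFin_comp_pow`).  Used by `CompositeOrder161` (the four `⟨κ⟩`-orbits of length `161` on the `644` moved columns).
Ours (elementary), not literature; no `sorry`.
-/

namespace Summit.Ventures.DiscreteObjects.Hadamard

open Finset BigOperators

variable {ι : Type*} [DecidableEq ι]

-- Throughout, a point `j` is called FREE (for `κ`, below `n`) if `∀ k, 0 < k → k < n → (κ ^ k) j ≠ j`.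

omit [DecidableEq ι] in
/-- cancelling a common power: `κ^a j = κ^b j` with `a ≤ b` gives `κ^(b-a) j = j` -/
lemma pow_apply_eq_pow_apply {κ : Equiv.Perm ι} {j : ι} {a b : ℕ} (hab : a ≤ b)
    (h : (κ ^ a) j = (κ ^ b) j) : (κ ^ (b - a)) j = j := by
  obtain ⟨d, rfl⟩ := Nat.exists_eq_add_of_le hab
  rw [pow_add, Equiv.Perm.mul_apply] at h
  rw [Nat.add_sub_cancel_left]
  exact ((κ ^ a).injective h).symm

omit [DecidableEq ι] in
/-- the listing `k ↦ κ^k j`, `k < n`, of a free point is injective -/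
lemma orbFin_injOn_of_free {κ : Equiv.Perm ι} {n : ℕ} {j : ι} (hfree : ∀ k, 0 < k → k < n → (κ ^ k) j ≠ j) :
    Set.InjOn (fun k => (κ ^ k) j) (Finset.range n : Set ℕ) := by
  intro a ha b hb hab
  simp only [Finset.coe_range, Set.mem_Iio] at ha hb
  by_contra hne
  rcases Nat.lt_or_gt_of_ne hne with hlt | hlt
  · exact hfree (b - a) (Nat.sub_pos_of_lt hlt) (by omega) (pow_apply_eq_pow_apply hlt.le hab)
  · exact hfree (a - b) (Nat.sub_pos_of_lt hlt) (by omega) (pow_apply_eq_pow_apply hlt.le hab.symm)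

/-- the orbit of a free point has `n` elements -/
lemma card_orbFin_of_free {κ : Equiv.Perm ι} {n : ℕ} {j : ι} (hfree : ∀ k, 0 < k → k < n → (κ ^ k) j ≠ j) : (orbFin κ n j).card = n := by
  unfold orbFin
  rw [Finset.card_image_of_injOn (orbFin_injOn_of_free hfree), Finset.card_range]

/-- **orbit sums of a free point are sums over the exponents** -/
lemma sum_orbFin_of_free {κ : Equiv.Perm ι} {n : ℕ} {j : ι} (hfree : ∀ k, 0 < k → k < n → (κ ^ k) j ≠ j) (f : ι → ℤ) :
    ∑ x ∈ orbFin κ n j, f x = ∑ k ∈ Finset.range n, f ((κ ^ k) j) := by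
  unfold orbFin
  rw [Finset.sum_image (orbFin_injOn_of_free hfree)]

/-- the orbit of a point of the orbit is contained in the orbit (needs only `κ^n = 1`) -/
lemma orbFin_subset_of_mem {κ : Equiv.Perm ι} {n : ℕ} (hn : 0 < n) (hκ : κ ^ n = 1) {j x : ι}
    (hx : x ∈ orbFin κ n j) : orbFin κ n x ⊆ orbFin κ n j := by
  intro y hy
  obtain ⟨i, -, rfl⟩ := Finset.mem_image.mp hx
  obtain ⟨l, -, rfl⟩ := Finset.mem_image.mp hy
  rw [← Equiv.Perm.mul_apply, ← pow_add]
  exact pow_apply_mem_orbFin κ hn hκ j _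

/-- orbits of points of the orbit of a free point coincide with it (the points being free as well) -/
lemma orbFin_eq_of_mem_of_free {κ : Equiv.Perm ι} {n : ℕ} (hn : 0 < n) (hκ : κ ^ n = 1) {j x : ι}
    (hfree : ∀ k, 0 < k → k < n → (κ ^ k) j ≠ j) (hfreex : ∀ k, 0 < k → k < n → (κ ^ k) x ≠ x) (hx : x ∈ orbFin κ n j) : orbFin κ n x = orbFin κ n j := by
  apply Finset.eq_of_subset_of_card_le (orbFin_subset_of_mem hn hκ hx)
  rw [card_orbFin_of_free hfree, card_orbFin_of_free hfreex]

/-- **distinct orbits are disjoint**: if `x` is not in the orbit of `j` (all points involved free), the orbits are disjoint -/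
lemma disjoint_orbFin_of_not_mem {κ : Equiv.Perm ι} {n : ℕ} (hn : 0 < n) (hκ : κ ^ n = 1) {j x : ι}
    (hfree : ∀ k, 0 < k → k < n → (κ ^ k) j ≠ j) (hfreex : ∀ k, 0 < k → k < n → (κ ^ k) x ≠ x) (hfreeall : ∀ y ∈ orbFin κ n j, ∀ k, 0 < k → k < n → (κ ^ k) y ≠ y)
    (hx : x ∉ orbFin κ n j) : Disjoint (orbFin κ n j) (orbFin κ n x) := by
  rw [Finset.disjoint_left]
  intro y hy hy'
  apply hx
  have e1 : orbFin κ n y = orbFin κ n j := orbFin_eq_of_mem_of_free hn hκ hfree (hfreeall y hy) hy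
  have e2 : orbFin κ n y = orbFin κ n x := orbFin_eq_of_mem_of_free hn hκ hfreex (hfreeall y hy) hy'
  rw [← e1, e2]
  exact mem_orbFin_self κ hn x

/-- the orbit is mapped onto itself by every power of `κ` (only `κ^n = 1` is needed; cf. `image_pow_orbFin` for prime `n`) -/
lemma image_pow_orbFin' {κ : Equiv.Perm ι} {n : ℕ} (hn : 0 < n) (hκ : κ ^ n = 1) (j : ι) (m : ℕ) :
    (orbFin κ n j).image (κ ^ m) = orbFin κ n j := by
  apply Finset.eq_of_subset_of_card_le
  · intro y hy
    obtain ⟨x, hx, rfl⟩ := Finset.mem_image.mp hy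
    obtain ⟨i, -, rfl⟩ := Finset.mem_image.mp hx
    rw [← Equiv.Perm.mul_apply, ← pow_add]
    exact pow_apply_mem_orbFin κ hn hκ j _
  · rw [Finset.card_image_of_injective _ (κ ^ m).injective]

/-- **orbit sums are invariant under powers of `κ`** -/
lemma sum_orbFin_comp_pow {κ : Equiv.Perm ι} {n : ℕ} (hn : 0 < n) (hκ : κ ^ n = 1) (j : ι) (m : ℕ) (f : ι → ℤ) :
    ∑ x ∈ orbFin κ n j, f ((κ ^ m) x) = ∑ x ∈ orbFin κ n j, f x := by
  conv_rhs => rw [← image_pow_orbFin' hn hκ j m]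
  rw [Finset.sum_image (fun x _ y _ h => (κ ^ m).injective h)]

/-- a function invariant under `κ` is constant on orbits: its orbit sum is `n` times its value -/
lemma sum_orbFin_of_invariant {κ : Equiv.Perm ι} {n : ℕ} {j : ι} (hfree : ∀ k, 0 < k → k < n → (κ ^ k) j ≠ j) (f : ι → ℤ)
    (hf : ∀ x, f (κ x) = f x) : ∑ x ∈ orbFin κ n j, f x = n * f j := by
  have hpow : ∀ k x, f ((κ ^ k) x) = f x := by
    intro k
    induction k with
    | zero => intro x; simp
    | succ k ih => intro x; rw [pow_succ', Equiv.Perm.mul_apply, hf, ih]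
  rw [sum_orbFin_of_free hfree, Finset.sum_congr rfl fun k _ => hpow k j, Finset.sum_const, Finset.card_range,
    nsmul_eq_mul]

/-- points of the orbit of a point of a `κ`-stable finset stay in the finset -/
lemma orbFin_subset_of_stable {κ : Equiv.Perm ι} {n : ℕ} (Y : Finset ι) (hY : ∀ y ∈ Y, κ y ∈ Y) {j : ι} (hj : j ∈ Y) :
    orbFin κ n j ⊆ Y := by
  have hpow : ∀ k, ∀ y ∈ Y, (κ ^ k) y ∈ Y := by
    intro k
    induction k with
    | zero => intro y hy; simpa using hy
    | succ k ih => intro y hy; rw [pow_succ', Equiv.Perm.mul_apply]; exact hY _ (ih y hy)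
  intro x hx
  obtain ⟨i, -, rfl⟩ := Finset.mem_image.mp hx
  exact hpow i j hj

end Summit.Ventures.DiscreteObjects.Hadamard
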